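import Mathlib
import Summits.MatrixMultiplication.MatrixMultiplication.Theorems.LevelGradedCohnUmansLevelOneGL2DesignsTangencyTransport

/-!
# Homogeneous strong representative systems from split-torus orbits, certified in `O(p)`
(stub `stub_tangencySets`, crux `LevelOneGL2Designs`, stmt-MatrixMultiplication-14080; wall-breaker axis 3/12)

A *bimonomial torus orbit* of `AG(2,p)`: for a unit `g` of order `n` and naturals `a, b, c`, the
point set `T = {(g^{a i}, g^{b i + c j})}` — the orbit of `(1,1)` under the subgroup
`H = ⟨(a,b), (0,c)⟩ + nℤ²` of the split torus `(𝔽_p^×)² ≅ ℤ_n²` acting diagonally.  `T` is closed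
under the diagonal matrices `diag(g^{a i}, g^{b i + c j})`, which act transitively on it, so by the
transport lemma `srs_of_transitive` it is a tangency set as soon as ONE origin-avoiding line
`{u x + v y = 1}` through `(1,1)` meets it only there.  That last condition is certified in `O(p)`
kernel steps: every point of `T` satisfies the two character equations
`x^{α₁} y^{β₁} = 1`, `x^{α₂} y^{β₂} = 1` (for exponents annihilating `H`), so it suffices to check
that no point `(t, (1 − u t)/v)` of the line other than `t = 1` satisfies them (`hline`, decidable,
`p` evaluations).  The size is certified from below by an injective sub-parametrisation
(`i < n/a`, `j < n/c`), using `orderOf g = n`.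

* `srs_of_torusOrbit` — the generic theorem (conclusion in the planner's `k ≤ S.card` shape);
* instances: the EXACT homogeneous maxima found by this seat's enumeration of all subgroups of
  `ℤ_n²` (`kit/srsjob/single_orbit.py`) at `p = 97` (576 = 0.603·p^{3/2}, one orbit of index 16),
  `p = 113` (784 = 0.653·p^{3/2}, index 16) and `p = 193` (1536 = 0.573·p^{3/2}, index 24) —
  sizes no unstructured search has reached at these primes, each certified by a few hundred
  modular exponentiations instead of ≈ 10⁶ pair tests.

Why such large single orbits exist and why they still do not scale: a subgroup of index `e` is a
tangency set iff one of the `p + 1` punctured lines through `(1,1)` misses its identity coset, an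
event of probability ≈ `(p+1)·e^{−(p−2)/e}` per subgroup; maximising `p²/e` over the (many, for
smooth `p − 1`) subgroups gives `Θ(p log p)` with a constant that tracks the number of subgroups —
exactly what the exact table shows (`max/(p ln p)` between 0.6 for `p − 1 = 2·prime` and 1.5 for
`p − 1 = 2⁶·3`).  See AXIS.md §B of this seat.
-/

set_option linter.dupNamespace false -- `MatrixMultiplication.MatrixMultiplication` (summit = problem, D-0017)

open Finset Matrix

namespace Summit.MatrixMultiplication.MatrixMultiplication.Theorems.LevelOneGL2Designs.FlagLine

section TorusOrbit

variable {p : ℕ}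

/-- Powers of a unit of order `n` with exponents congruent mod `n` agree (in `ZMod p`). [elementary] -/
theorem unit_pow_eq_pow_of_modEq (g : (ZMod p)ˣ) {n k k' : ℕ} (hord : orderOf g = n)
    (h : k ≡ k' [MOD n]) : (g : ZMod p) ^ k = (g : ZMod p) ^ k' := by
  have h2 : g ^ k = g ^ k' := pow_eq_pow_iff_modEq.mpr (hord ▸ h)
  have := congrArg (fun x : (ZMod p)ˣ => (x : ZMod p)) h2
  simpa [Units.val_pow_eq_pow_val] using this

/-- Exponents of equal powers of a unit of order `n` are congruent mod `n`. [elementary] -/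
theorem modEq_of_unit_pow_eq_pow (g : (ZMod p)ˣ) {n k k' : ℕ} (hord : orderOf g = n)
    (h : (g : ZMod p) ^ k = (g : ZMod p) ^ k') : k ≡ k' [MOD n] := by
  have h2 : g ^ k = g ^ k' := by
    ext
    simpa [Units.val_pow_eq_pow_val] using h
  exact hord ▸ pow_eq_pow_iff_modEq.mp h2

/-- A power of a unit of order `n` with exponent divisible by `n` is `1`. [elementary] -/
theorem unit_pow_eq_one_of_dvd (g : (ZMod p)ˣ) {n k : ℕ} (hord : orderOf g = n) (h : n ∣ k) :
    (g : ZMod p) ^ k = 1 := by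
  have := unit_pow_eq_pow_of_modEq g hord ((Nat.modEq_zero_iff_dvd.mpr h) : k ≡ 0 [MOD n])
  simpa using this

/-- **Homogeneous SRS from a split-torus orbit, certified in `O(p)`.**  Let `g` be a unit of
`ZMod p` of order `n`, `a·m₁ = n`, `c·m₂ = n`, and let `α₁,β₁,α₂,β₂` annihilate the subgroup
`⟨(a,b),(0,c)⟩ ≤ ℤ_n²` (`n ∣ αᵢ a + βᵢ b`, `n ∣ βᵢ c`).  If the line `u x + v y = 1` through `(1,1)`
(`u + v = 1`, `v w = 1`) contains no point `(t, (1−ut)w)` with `t ≠ 1` satisfying both character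
equations, then the orbit `{(g^{a i}, g^{b i + c j})}` carries a normal-form strong representative
system with at least `m₁·m₂` flags. [elementary; transport lemma `srs_of_transitive`] -/
theorem srs_of_torusOrbit (g : (ZMod p)ˣ) (n a b c m₁ m₂ : ℕ) (hord : orderOf g = n)
    (ha : a * m₁ = n) (hc : c * m₂ = n) (hn : 0 < n)
    (α₁ β₁ α₂ β₂ : ℕ) (h11 : n ∣ α₁ * a + β₁ * b) (h12 : n ∣ β₁ * c)
    (h21 : n ∣ α₂ * a + β₂ * b) (h22 : n ∣ β₂ * c)
    (u v w : ZMod p) (huv : u + v = 1) (hvw : v * w = 1)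
    (hline : ∀ t : ZMod p, t ^ α₁ * ((1 - u * t) * w) ^ β₁ = 1 →
      t ^ α₂ * ((1 - u * t) * w) ^ β₂ = 1 → t = 1) :
    ∃ S : Finset ((Fin 2 → ZMod p) × (Fin 2 → ZMod p)),
      m₁ * m₂ ≤ S.card ∧ ∀ f ∈ S, ∀ f' ∈ S, (dotProduct f.1 f'.2 = 1 ↔ f = f') := by
  classical
  set G : ZMod p := (g : ZMod p) with hG
  -- the orbit
  let pt : ℕ × ℕ → (Fin 2 → ZMod p) := fun ij => ![G ^ (a * ij.1), G ^ (b * ij.1 + c * ij.2)]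
  let T : Finset (Fin 2 → ZMod p) := ((range n) ×ˢ (range n)).image pt
  have hmemT : ∀ i j, i < n → j < n → pt (i, j) ∈ T := fun i j hi hj =>
    mem_image.mpr ⟨(i, j), mem_product.mpr ⟨mem_range.mpr hi, mem_range.mpr hj⟩, rfl⟩
  -- character equations on the orbit
  have hchar : ∀ (α β : ℕ), n ∣ α * a + β * b → n ∣ β * c → ∀ i j : ℕ,
      (G ^ (a * i)) ^ α * (G ^ (b * i + c * j)) ^ β = 1 := by
    intro α β hα hβ i j
    rw [← pow_mul, ← pow_mul, ← pow_add]
    apply unit_pow_eq_one_of_dvd g hord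
    have e : a * i * α + (b * i + c * j) * β = (α * a + β * b) * i + (β * c) * j := by ring
    rw [e]
    exact dvd_add (dvd_mul_of_dvd_left hα _) (dvd_mul_of_dvd_left hβ _)
  -- the private line at (1,1)
  have h1u : 1 - u = v := by rw [← huv]; ring
  have hpriv : ∀ y ∈ T, y ⬝ᵥ ![u, v] = 1 → y = ![1, 1] := by
    intro y hy hyb
    obtain ⟨⟨i, j⟩, -, rfl⟩ := mem_image.mp hy
    have hdot : (pt (i, j)) ⬝ᵥ ![u, v] = G ^ (a * i) * u + G ^ (b * i + c * j) * v := by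
      simp [pt, dotProduct, Fin.sum_univ_two]
    rw [hdot] at hyb
    -- second coordinate in terms of the first
    have hy1 : G ^ (b * i + c * j) = (1 - u * G ^ (a * i)) * w := by
      linear_combination w * hyb - (G ^ (b * i + c * j)) * hvw
    have e1 := hchar α₁ β₁ h11 h12 i j
    have e2 := hchar α₂ β₂ h21 h22 i j
    rw [hy1] at e1 e2
    have ht : G ^ (a * i) = 1 := hline _ e1 e2
    have hy1' : G ^ (b * i + c * j) = 1 := by
      rw [hy1, ht, mul_one, h1u, hvw]
    show pt (i, j) = ![1, 1]
    simp only [pt, ht, hy1']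
  -- transitive diagonal action
  have hGn : ∀ k q : ℕ, G ^ (k + n * q) = G ^ k := fun k q =>
    unit_pow_eq_pow_of_modEq g hord
      ((Nat.modEq_iff_dvd' (Nat.le_add_right k _)).mpr (by simp) |>.symm)
  have hmod : ∀ k : ℕ, ∀ w : ℕ, G ^ (w * (k % n)) = G ^ (w * k) := by
    intro k w
    conv_rhs => rw [← Nat.mod_add_div k n]
    rw [mul_add, show w * (n * (k / n)) = n * (w * (k / n)) by ring, hGn]
  have htrans : ∀ x ∈ T, ∃ M : Matrix (Fin 2) (Fin 2) (ZMod p),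
      IsUnit M.det ∧ M *ᵥ ![1, 1] = x ∧ ∀ y ∈ T, M *ᵥ y ∈ T := by
    intro x hx
    obtain ⟨⟨i, j⟩, -, rfl⟩ := mem_image.mp hx
    refine ⟨diagonal (pt (i, j)), ?_, ?_, ?_⟩
    · rw [det_diagonal]
      simp only [Fin.prod_univ_two, pt, Matrix.cons_val_zero, Matrix.cons_val_one]
      have hu := (g ^ (a * i) * g ^ (b * i + c * j)).isUnit
      simpa [Units.val_pow_eq_pow_val, hG] using hu
    · funext k
      rw [mulVec_diagonal]
      fin_cases k <;> simp [pt]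
    · intro y hy
      obtain ⟨⟨i', j'⟩, -, rfl⟩ := mem_image.mp hy
      have : diagonal (pt (i, j)) *ᵥ pt (i', j') = pt ((i + i') % n, (j + j') % n) := by
        funext k
        rw [mulVec_diagonal]
        fin_cases k
        · simp only [pt, Fin.zero_eta, Matrix.cons_val_zero]
          rw [hmod, ← pow_add]; ring_nf
        · simp only [pt, Fin.mk_one, Matrix.cons_val_one, Matrix.cons_val_zero]
          rw [← pow_add]
          have e : b * ((i + i') % n) + c * ((j + j') % n) + n * (b * ((i + i') / n) + c * ((j + j') / n))
              = b * (i + i') + c * (j + j') := by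
            have h1 := Nat.mod_add_div (i + i') n
            have h2 := Nat.mod_add_div (j + j') n
            nlinarith [h1, h2]
          rw [← hGn (b * ((i + i') % n) + c * ((j + j') % n))
            (b * ((i + i') / n) + c * ((j + j') / n)), e]
          ring_nf
      rw [this]
      exact hmemT _ _ (Nat.mod_lt _ hn) (Nat.mod_lt _ hn)
  -- transport
  have h₀ : (![1, 1] : Fin 2 → ZMod p) ⬝ᵥ ![u, v] = 1 := by
    simp [dotProduct, Fin.sum_univ_two, huv]
  obtain ⟨S, hS, hsrs⟩ := srs_of_transitive T ![1, 1] ![u, v] h₀ hpriv htrans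
  refine ⟨S, ?_, hsrs⟩
  rw [hS]
  -- size from below: injective sub-parametrisation
  have ha0 : 0 < a := Nat.pos_of_ne_zero fun h0 => by rw [h0, zero_mul] at ha; omega
  have hc0 : 0 < c := Nat.pos_of_ne_zero fun h0 => by rw [h0, zero_mul] at hc; omega
  have hm₁ : m₁ ≤ n := by rw [← ha]; exact Nat.le_mul_of_pos_left _ ha0
  have hm₂ : m₂ ≤ n := by rw [← hc]; exact Nat.le_mul_of_pos_left _ hc0
  have hsub : ((range m₁) ×ˢ (range m₂)).image pt ⊆ T := by
    intro y hy
    obtain ⟨⟨i, j⟩, hij, rfl⟩ := mem_image.mp hy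
    rw [mem_product, mem_range, mem_range] at hij
    exact hmemT i j (lt_of_lt_of_le hij.1 hm₁) (lt_of_lt_of_le hij.2 hm₂)
  have hinj : Set.InjOn pt ((range m₁) ×ˢ (range m₂) : Finset (ℕ × ℕ)) := by
    rintro ⟨i, j⟩ hij ⟨i', j'⟩ hij' h
    simp only [coe_product, coe_range, Set.mem_prod, Set.mem_Iio] at hij hij'
    have h0 := congrFun h 0
    have h1 := congrFun h 1
    simp only [pt, Matrix.cons_val_zero, Matrix.cons_val_one] at h0 h1
    have hi : a * i = a * i' := by
      apply Nat.ModEq.eq_of_lt_of_lt (modEq_of_unit_pow_eq_pow g hord h0)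
      · calc a * i < a * m₁ := Nat.mul_lt_mul_of_pos_left hij.1 ha0
          _ = n := ha
      · calc a * i' < a * m₁ := Nat.mul_lt_mul_of_pos_left hij'.1 ha0
          _ = n := ha
    have hii : i = i' := Nat.eq_of_mul_eq_mul_left ha0 hi
    subst hii
    have hj' : b * i + c * j ≡ b * i + c * j' [MOD n] := modEq_of_unit_pow_eq_pow g hord h1
    have hj2 : c * j ≡ c * j' [MOD n] := Nat.ModEq.add_left_cancel' _ hj'
    have hj3 : c * j = c * j' := by
      apply Nat.ModEq.eq_of_lt_of_lt hj2
      · calc c * j < c * m₂ := Nat.mul_lt_mul_of_pos_left hij.2 hc0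
          _ = n := hc
      · calc c * j' < c * m₂ := Nat.mul_lt_mul_of_pos_left hij'.2 hc0
          _ = n := hc
    have hjj : j = j' := Nat.eq_of_mul_eq_mul_left hc0 hj3
    subst hjj
    rfl
  calc m₁ * m₂ = #(((range m₁) ×ˢ (range m₂)).image pt) := by
        rw [card_image_of_injOn hinj, card_product, card_range, card_range]
    _ ≤ #T := card_le_card hsub

end TorusOrbit

section Instances

/-- **Homogeneous record `T(97) ≥ 576`** (0.603·p^(3/2)): the single orbit
`{(x,y) ∈ (𝔽_97^×)² : x^6·y^54 = 1}` = `{(5^i, 5^(7i+16j))}` (a subgroup of index 16 of the split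
torus, 576 points) is a tangency set — the line `49x + 49y = 1` through `(1,1)` is private —
the EXACT maximum over all subgroups of `ℤ_96²` (`kit/srsjob/single_orbit.py`); certified by
`srs_of_torusOrbit` with 97 evaluations of the character equation on that line. [computation, this seat] -/
theorem srs_torusOrbitAt_97_576 : ∃ S : Finset ((Fin 2 → ZMod 97) × (Fin 2 → ZMod 97)),
    576 ≤ S.card ∧ ∀ f ∈ S, ∀ f' ∈ S, (dotProduct f.1 f'.2 = 1 ↔ f = f') := by
  have hord : orderOf (ZMod.unitOfCoprime 5 (by decide) : (ZMod 97)ˣ) = 96 := by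
    refine orderOf_eq_of_pow_and_pow_div_prime (by norm_num) (by decide +kernel) ?_
    intro q hq hqd
    have hq' : q ∈ Nat.primeFactors 96 := Nat.mem_primeFactors.mpr ⟨hq, hqd, by norm_num⟩
    rw [show Nat.primeFactors 96 = {2, 3} from by decide +kernel] at hq'
    simp only [Finset.mem_insert, Finset.mem_singleton] at hq'
    rcases hq' with rfl | rfl <;> decide +kernel
  exact srs_of_torusOrbit (p := 97) (ZMod.unitOfCoprime 5 (by decide)) 96 1 7 16 96 6 hord
    (by norm_num) (by norm_num) (by norm_num) 6 54 0 0 (by decide) (by decide) (by decide) (by decide)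
    49 49 2 (by decide) (by decide) (by decide +kernel)

/-- **Homogeneous record `T(113) ≥ 784`** (0.653·p^(3/2)): the single orbit
`{(x,y) ∈ (𝔽_113^×)² : x^7·y^63 = 1}` = `{(3^i, 3^(7i+16j))}` (a subgroup of index 16 of the split
torus, 784 points) is a tangency set — the line `57x + 57y = 1` through `(1,1)` is private —
the EXACT maximum over all subgroups of `ℤ_112²` (`kit/srsjob/single_orbit.py`); certified by
`srs_of_torusOrbit` with 113 evaluations of the character equation on that line. [computation, this seat] -/
theorem srs_torusOrbitAt_113_784 : ∃ S : Finset ((Fin 2 → ZMod 113) × (Fin 2 → ZMod 113)),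
    784 ≤ S.card ∧ ∀ f ∈ S, ∀ f' ∈ S, (dotProduct f.1 f'.2 = 1 ↔ f = f') := by
  have hord : orderOf (ZMod.unitOfCoprime 3 (by decide) : (ZMod 113)ˣ) = 112 := by
    refine orderOf_eq_of_pow_and_pow_div_prime (by norm_num) (by decide +kernel) ?_
    intro q hq hqd
    have hq' : q ∈ Nat.primeFactors 112 := Nat.mem_primeFactors.mpr ⟨hq, hqd, by norm_num⟩
    rw [show Nat.primeFactors 112 = {2, 7} from by decide +kernel] at hq'
    simp only [Finset.mem_insert, Finset.mem_singleton] at hq'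
    rcases hq' with rfl | rfl <;> decide +kernel
  exact srs_of_torusOrbit (p := 113) (ZMod.unitOfCoprime 3 (by decide)) 112 1 7 16 112 7 hord
    (by norm_num) (by norm_num) (by norm_num) 7 63 0 0 (by decide) (by decide) (by decide) (by decide)
    57 57 2 (by decide) (by decide) (by decide +kernel)

/-- **Homogeneous record `T(193) ≥ 1536`** (0.573·p^(3/2)): the single orbit
`{(x,y) ∈ (𝔽_193^×)² : x^16·y^56 = 1}` = `{(5^i, 5^(10i+24j))}` (a subgroup of index 24 of the split
torus, 1536 points) is a tangency set — the line `35x + 159y = 1` through `(1,1)` is private —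
the EXACT maximum over all subgroups of `ℤ_192²` (`kit/srsjob/single_orbit.py`); certified by
`srs_of_torusOrbit` with 193 evaluations of the character equation on that line. [computation, this seat] -/
theorem srs_torusOrbitAt_193_1536 : ∃ S : Finset ((Fin 2 → ZMod 193) × (Fin 2 → ZMod 193)),
    1536 ≤ S.card ∧ ∀ f ∈ S, ∀ f' ∈ S, (dotProduct f.1 f'.2 = 1 ↔ f = f') := by
  have hord : orderOf (ZMod.unitOfCoprime 5 (by decide) : (ZMod 193)ˣ) = 192 := by
    refine orderOf_eq_of_pow_and_pow_div_prime (by norm_num) (by decide +kernel) ?_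
    intro q hq hqd
    have hq' : q ∈ Nat.primeFactors 192 := Nat.mem_primeFactors.mpr ⟨hq, hqd, by norm_num⟩
    rw [show Nat.primeFactors 192 = {2, 3} from by decide +kernel] at hq'
    simp only [Finset.mem_insert, Finset.mem_singleton] at hq'
    rcases hq' with rfl | rfl <;> decide +kernel
  exact srs_of_torusOrbit (p := 193) (ZMod.unitOfCoprime 5 (by decide)) 192 1 10 24 192 8 hord
    (by norm_num) (by norm_num) (by norm_num) 16 56 0 0 (by decide) (by decide) (by decide) (by decide)
    35 159 17 (by decide) (by decide) (by decide +kernel)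

end Instances


end Summit.MatrixMultiplication.MatrixMultiplication.Theorems.LevelOneGL2Designs.FlagLine
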